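import Mathlib

/-!
# The spectral side of a finite two-period trace identity (support, seat p1)

Finite-dimensional linear algebra: on an inner product space `H` with an orthonormal basis `φ_i`, a linear
operator `R` and two vectors `v_A, v_B` (the Riesz vectors of two functionals `P_A = ⟪·, v_A⟫`,
`P_B = ⟪·, v_B⟫`), the «kernel pairing» `⟪R v_B, v_A⟫` expands as the spectral sum
`∑_i P_A(R φ_i) · conj P_B(φ_i)` (`inner_apply_eq_sum`); hence if the pairing is non-zero, some basis vector has
BOTH `P_A(R φ_i) ≠ 0` and `P_B(φ_i) ≠ 0` (`exists_both_ne_zero_of_inner_ne_zero`), and, with `R` a projection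
onto a subspace `V` (`R ∘ R = R`), some vector `ψ ∈ V` has `P_A(ψ) ≠ 0` and `P_B(ψ) ≠ 0`
when `R` is self-adjoint — in fact `ψ = R v_B` itself (`exists_mem_both_ne_zero_of_inner_ne_zero`).

Nothing here is about any automorphic form, group, or period: it is the bookkeeping «geometric side ≠ 0 ⇒ a
spectral term with both periods non-zero» in its finite-dimensional form.
Blind lane: Mathlib only; no sorry; axioms ⊆ {propext, Classical.choice, Quot.sound}.
-/

namespace Summit.Ventures.HodgeRepro2.T7SupportSpectralSide

open scoped InnerProductSpace

variable {H : Type*} [NormedAddCommGroup H] [InnerProductSpace ℂ H]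
  {ι : Type*} [Fintype ι]

/-- **the spectral expansion**: `⟪R v_B, v_A⟫ = ∑_i ⟪R φ_i, v_A⟫ · ⟪v_B, φ_i⟫` for an orthonormal basis `φ`. -/
theorem inner_apply_eq_sum (b : OrthonormalBasis ι ℂ H) (R : H →ₗ[ℂ] H) (vA vB : H) :
    ⟪R vB, vA⟫_ℂ = ∑ i, ⟪R (b i), vA⟫_ℂ * ⟪vB, b i⟫_ℂ := by
  conv_lhs => rw [← b.sum_repr' vB]
  rw [map_sum, sum_inner]
  refine Finset.sum_congr rfl fun i _ => ?_
  rw [map_smul, inner_smul_left, inner_conj_symm]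
  ring

/-- **a non-zero pairing has a spectral term with both periods non-zero**. -/
theorem exists_both_ne_zero_of_inner_ne_zero (b : OrthonormalBasis ι ℂ H) (R : H →ₗ[ℂ] H)
    (vA vB : H) (h : ⟪R vB, vA⟫_ℂ ≠ 0) :
    ∃ i, ⟪R (b i), vA⟫_ℂ ≠ 0 ∧ ⟪b i, vB⟫_ℂ ≠ 0 := by
  rw [inner_apply_eq_sum b R vA vB] at h
  obtain ⟨i, _, hi⟩ := Finset.exists_ne_zero_of_sum_ne_zero h
  refine ⟨i, ?_, ?_⟩
  · intro h0
    exact hi (by rw [h0, zero_mul])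
  · intro h0
    apply hi
    have : ⟪vB, b i⟫_ℂ = 0 := by
      rw [← inner_conj_symm, h0, map_zero]
    rw [this, mul_zero]

/-- **the term lives in the range of a self-adjoint projection**: if `R` is idempotent and self-adjoint (the
orthogonal projection onto `V = range R`), a non-zero pairing `⟪R v_B, v_A⟫` gives `ψ = R v_B ∈ V` with
`P_A(ψ) = ⟪ψ, v_A⟫ ≠ 0` and `P_B(ψ) = ⟪ψ, v_B⟫ = ‖R v_B‖² ≠ 0`. -/
theorem exists_mem_both_ne_zero_of_inner_ne_zero (R : H →ₗ[ℂ] H)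
    (hidem : ∀ x, R (R x) = R x) (hsa : ∀ x y, ⟪R x, y⟫_ℂ = ⟪x, R y⟫_ℂ)
    (vA vB : H) (h : ⟪R vB, vA⟫_ℂ ≠ 0) :
    ∃ ψ ∈ LinearMap.range R, ⟪ψ, vA⟫_ℂ ≠ 0 ∧ ⟪ψ, vB⟫_ℂ ≠ 0 := by
  refine ⟨R vB, ⟨vB, rfl⟩, h, ?_⟩
  have hne : R vB ≠ 0 := by
    intro h0
    rw [h0, inner_zero_left] at h
    exact h rfl
  have : ⟪R vB, vB⟫_ℂ = ⟪R vB, R vB⟫_ℂ := by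
    conv_lhs => rw [← hidem vB]
    rw [hsa]
  rw [this]
  exact inner_self_ne_zero.2 hne

/-- **a common constituent** (appended): if the orthonormal basis is adapted to a family of subspaces `V l`
stable under `R` (`b i ∈ V (lab i)`, `R` maps `V l` into `V l`), a non-zero pairing `⟪R v_B, v_A⟫` gives ONE
label `l` whose subspace carries both functionals: `x ∈ V l` with `⟪x, v_A⟫ ≠ 0` and `y ∈ V l` with
`⟪y, v_B⟫ ≠ 0` (`x = R φ_i`, `y = φ_i`). -/
theorem exists_label_both_ne_zero_of_inner_ne_zero {L : Type*} (b : OrthonormalBasis ι ℂ H)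
    (R : H →ₗ[ℂ] H) (V : L → Submodule ℂ H) (lab : ι → L) (hb : ∀ i, b i ∈ V (lab i))
    (hR : ∀ l, ∀ x ∈ V l, R x ∈ V l) (vA vB : H) (h : ⟪R vB, vA⟫_ℂ ≠ 0) :
    ∃ l, (∃ x ∈ V l, ⟪x, vA⟫_ℂ ≠ 0) ∧ (∃ y ∈ V l, ⟪y, vB⟫_ℂ ≠ 0) := by
  obtain ⟨i, hA, hB⟩ := exists_both_ne_zero_of_inner_ne_zero b R vA vB h
  exact ⟨lab i, ⟨R (b i), hR _ _ (hb i), hA⟩, ⟨b i, hb i, hB⟩⟩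

end Summit.Ventures.HodgeRepro2.T7SupportSpectralSide
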